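import Summits.Ventures.QEC.Census.BB.BB72.Cert
import Summits.Ventures.QEC.Census.BB.BB72.MitmTreeX

/-!
# `BB72`: meet-in-the-middle lower-bound replay, side `X` — KERNEL tier

`cert.mitmX 3 2 posX treeX = true` by `decide +kernel` (no `Lean.ofReduceBool`): every X-type word of weight
`1 … 5` with zero HZ-syndrome is allow-listed (here: 0 allow-list entries), CERT-FORMAT v1 §5.2 / §4 L4, checker and
soundness `Summits.Ventures.QEC.Census.CertCheckMitm` (`DistCert.dX_code_of_mitm` turns this + `cert.checkStructure` into
`dX = 6`). Measured kernel time ≈ 35 s (farm, 2026-08-26).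
-/

namespace Summit.Ventures.QEC.Census.BB72

open Summit.Ventures.QEC.Census

/-- side X of `BB72`: the meet-in-the-middle replay `wmax = 5 = 3 + 2` passes — KERNEL (`decide +kernel`). -/
theorem mitmX_ok : Summit.Ventures.QEC.Census.BB72.cert.mitmX 3 2 posX treeX = true := by
  decide +kernel

end Summit.Ventures.QEC.Census.BB72
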